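import Summits.AtomisticToContinuum.Crystallization.Theorems.ReggeStarCoercivityDefectFreeCrystallizesPalmDefs
import Summits.AtomisticToContinuum.Crystallization.Theorems.MinimiserShells.Negative.LoadBearing
import Summits.AtomisticToContinuum.Crystallization.Theorems.ChargedEnergyGap.Negative.Periodisation
import Summits.AtomisticToContinuum.Crystallization.Theorems.PalmUnimodularRigidityMinimiserShellsDeepBadPricingOfShellNoBoundary
import Summits.AtomisticToContinuum.Crystallization.Theorems.PalmUnimodularRigidityMinimiserShellsQualShellNoBoundaryOfPeriodicShellGap

/-!
# The funnel periodic shell gap gives the funnel finite gap (stub F13 of line `palm-good-law`, crux stmt-AtomisticToContinuum-13603)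

Stub `stub_funnelFiniteGap_of_funnelPeriodicShellGap` of the lead-c2 skeleton `Cruxes/DefectFreeCrystallizes/Lines/palm_good_law.lean`.
Template: 9225's S13 `Theorems/PalmUnimodularRigidityMinimiserShellsQualShellNoBoundaryOfPeriodicShellGap.lean`
(`PeriodicShellGap.stub_qualShellNoBoundary_of_periodicShellGap`: periodise `y` with the cubic lattice of period `2Σ‖yᵢ‖ + 2`,
`goodShell_periodise_iff`, `natCard_bad_le_natCard_badMotif_periodise`, `energyPerParticle_periodise_le`); the one new
ingredient is the locality of `SetGood` (open ball `6/5 < 3/2`) under the periodisation.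

If the FUNNEL PERIODIC shell gap holds — for every threshold `t > 0` some `κ > 0` and `s > 0` such that every periodic
configuration `Q` of `ℝ³` with at most `s · #motif` motif sites not `SetGood` in `Q.points` and at least `t · #motif`
motif sites badly shelled in `Q.points` has `e* + κ ≤ e(Q)` — then the FUNNEL FINITE gap holds with the SAME `κ, s`
for each `t`: every finite injective configuration `y : Fin N → ℝ³` with at most `s · N` indices not `SetGood` in
`range y` and at least `t · N` badly-shelled indices has `N · (e* + κ) ≤ 𝓔_N(y)`.

Proof.  `N = 0` is `0 ≤ 0`.  For `N ≥ 1` periodise `y` (`ChargedEnergyGapNegative.periodise`, motif `{yᵢ}` of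
cardinality `N`).  Points of the periodisation within `3/2` of `yᵢ` are among the `yⱼ`
(`points_periodise_inter_closedBall_subset_range`), so both local predicates at the motif site `yᵢ` read in the
infinite point set agree with the predicates of index `i` read in `range y`: `GoodShell` by `goodShell_periodise_iff`
and `SetGood` — which only reads the points in the OPEN ball of radius `6/5 < 3/2` about the site — by
`setGood_congr_of_closedBall` / `setGood_periodise_iff`.  Hence `#bad motif ≥ #bad(y) ≥ t · N = t · #motif`
(`natCard_bad_le_natCard_badMotif_periodise`), `#non-SetGood motif ≤ #non-SetGood(y) ≤ s · N = s · #motif`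
(`natCard_notSetGoodMotif_periodise_le`: every motif site is some `yᵢ`), and
`e* + κ ≤ e(Q) ≤ 𝓔_N(y) / N` (`energyPerParticle_periodise_le`).
-/

noncomputable section

open MeasureTheory
open scoped ENNReal BigOperators Classical

namespace Summit.AtomisticToContinuum.Crystallization.Theorems.PalmGoodLaw.FunnelFiniteGap

open Literature.MathematicalPhysics.StatisticalMechanics (lennardJones interactionEnergy PeriodicConfiguration)
open Summit.AtomisticToContinuum.Crystallization.Theorems.MinimiserShells.Negative.LoadBearing (eStar GoodShell)
open Summit.AtomisticToContinuum.Crystallization.Theorems.PalmUnimodularRigidityMinimiserShells.ShellNoBoundary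
  (goodShell_count_restrict_image_sub_congr count_restrict_image_sub_singleton_ne_zero_iff)
open Summit.AtomisticToContinuum.Crystallization.Theorems.PalmUnimodularRigidityMinimiserShells.PeriodicShellGap
  (mem_motif_periodise range_subset_points_periodise points_periodise_inter_closedBall_subset_range
   goodShell_periodise_iff natCard_bad_le_natCard_badMotif_periodise)
open Summit.AtomisticToContinuum.Crystallization.Theorems.ChargedEnergyGapNegative
  (periodise periodUnit motif_periodise two_le_dist_of_mem_points energyPerParticle_periodise_le)

variable {N : ℕ}

/-! ## Locality of `SetGood` -/

/-- **Locality of `SetGood`.**  The predicate `SetGood S y` only reads the points of `S` in the open ball of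
radius `6/5` about `y`; so if `S ⊆ S'` and every point of `S'` within distance `R₀ ≥ 6/5` of `y` already lies
in `S`, then `y` is `SetGood` in `S'` iff it is `SetGood` in `S`. [folklore] -/
theorem setGood_congr_of_closedBall {S S' : Set (EuclideanSpace ℝ (Fin 3))} {y : EuclideanSpace ℝ (Fin 3)}
    {R₀ : ℝ} (hSS' : S ⊆ S') (hR₀ : 6 / 5 ≤ R₀) (hloc : S' ∩ Metric.closedBall y R₀ ⊆ S) :
    SetGood S' y ↔ SetGood S y := by
  have hset : {z : EuclideanSpace ℝ (Fin 3) | z ∈ S' ∧ z ≠ y ∧ dist z y < 6 / 5} =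
      {z : EuclideanSpace ℝ (Fin 3) | z ∈ S ∧ z ≠ y ∧ dist z y < 6 / 5} := by
    ext z
    simp only [Set.mem_setOf_eq]
    constructor
    · rintro ⟨hz, hne, hd⟩
      exact ⟨hloc ⟨hz, Metric.mem_closedBall.2 (by linarith)⟩, hne, hd⟩
    · rintro ⟨hz, hne, hd⟩
      exact ⟨hSS' hz, hne, hd⟩
  unfold SetGood
  rw [hset]

/-- **Motif `SetGood`ness read in the periodic point set is `SetGood`ness in `y`.**  The motif site `yᵢ` of the
periodisation `y + (2Σ‖yᵢ‖ + 2)ℤ³` is `SetGood` in the infinite point set iff it is `SetGood` in the finite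
configuration `range y` (`setGood_congr_of_closedBall` with `R₀ = 3/2`: the points of the periodisation within
`3/2` of `yᵢ` are among the `yⱼ`, `points_periodise_inter_closedBall_subset_range`). [folklore] -/
theorem setGood_periodise_iff (y : Fin N → EuclideanSpace ℝ (Fin 3)) (hN : 0 < N) (i : Fin N) :
    SetGood (periodise y (periodUnit y) le_rfl hN).points (y i) ↔ SetGood (Set.range y) (y i) :=
  setGood_congr_of_closedBall (range_subset_points_periodise y hN) (by norm_num : (6 : ℝ) / 5 ≤ 3 / 2)
    (points_periodise_inter_closedBall_subset_range y hN i)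

/-- **Non-`SetGood` motif sites are at most the non-`SetGood` indices.**  Every motif site of the periodisation is
some `yᵢ` (`motif_periodise`); choosing such an index gives an injection of the motif sites not `SetGood` in the
infinite point set into the indices not `SetGood` in `range y` (`setGood_periodise_iff`). [folklore] -/
theorem natCard_notSetGoodMotif_periodise_le (y : Fin N → EuclideanSpace ℝ (Fin 3)) (hN : 0 < N) :
    Nat.card {x : (periodise y (periodUnit y) le_rfl hN).motif //
        ¬ SetGood (periodise y (periodUnit y) le_rfl hN).points (x : EuclideanSpace ℝ (Fin 3))} ≤
      Nat.card {i : Fin N // ¬ SetGood (Set.range y) (y i)} := by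
  have hmem : ∀ x : (periodise y (periodUnit y) le_rfl hN).motif,
      ∃ i : Fin N, y i = (x : EuclideanSpace ℝ (Fin 3)) := by
    intro x
    have hx : (x : EuclideanSpace ℝ (Fin 3)) ∈ Finset.univ.image y := by
      rw [← motif_periodise y (periodUnit y) le_rfl hN]
      exact x.2
    obtain ⟨i, -, hi⟩ := Finset.mem_image.1 hx
    exact ⟨i, hi⟩
  choose idx hidx using hmem
  refine Nat.card_le_card_of_injective
    (fun x => (⟨idx x.1, fun h => x.2 (by
        rw [← hidx x.1]
        exact (setGood_periodise_iff y hN (idx x.1)).2 h)⟩ :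
      {i : Fin N // ¬ SetGood (Set.range y) (y i)})) ?_
  intro a b hab
  have h : idx a.1 = idx b.1 := congrArg Subtype.val hab
  apply Subtype.ext
  apply Subtype.ext
  rw [← hidx a.1, ← hidx b.1, h]

/-! ## The stub -/

/-- **Stub `stub_funnelFiniteGap_of_funnelPeriodicShellGap` (F13) of line `palm-good-law`.**  The funnel periodic
shell gap (periodic configurations with at most `s · #motif` motif sites not `SetGood` and at least `t · #motif`
motif sites badly shelled in `Q.points` have `e* + κ ≤ e(Q)`) implies the funnel finite gap (finite injective
configurations with at most `s · N` indices not `SetGood` and at least `t · N` badly-shelled indices have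
`N · (e* + κ) ≤ 𝓔_N`), with the same `κ, s` for each `t`: periodise `y` with the cubic lattice of period
`2Σ‖yᵢ‖ + 2`; both local predicates of the motif sites read in the periodic point set are those of `y`
(`goodShell_periodise_iff`, `setGood_periodise_iff`), so `#bad motif ≥ t · #motif`, `#non-SetGood motif ≤ s · #motif`,
and `e(Q) ≤ 𝓔_N(y) / N` (`energyPerParticle_periodise_le`). [folklore] -/
theorem stub_funnelFiniteGap_of_funnelPeriodicShellGap :
    (∀ t : ℝ, 0 < t → ∃ κ : ℝ, 0 < κ ∧ ∃ s : ℝ, 0 < s ∧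
      ∀ Q : Literature.MathematicalPhysics.StatisticalMechanics.PeriodicConfiguration 3,
        (Nat.card {x : Q.motif // ¬ SetGood Q.points (x : EuclideanSpace ℝ (Fin 3))} : ℝ) ≤
            s * (Q.motif.card : ℝ) →
        t * (Q.motif.card : ℝ) ≤ (Nat.card {x : Q.motif // ¬ GoodShell
            ((Measure.count : Measure (EuclideanSpace ℝ (Fin 3))).restrict
              ((fun z => z - (x : EuclideanSpace ℝ (Fin 3))) '' Q.points))} : ℝ) →
        eStar + κ ≤ Q.energyPerParticle lennardJones) →
    ∀ t : ℝ, 0 < t → ∃ κ : ℝ, 0 < κ ∧ ∃ s : ℝ, 0 < s ∧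
      ∀ (N : ℕ) (y : Fin N → EuclideanSpace ℝ (Fin 3)), Function.Injective y →
        (Nat.card {i : Fin N // ¬ SetGood (Set.range y) (y i)} : ℝ) ≤ s * (N : ℝ) →
        t * (N : ℝ) ≤ (Nat.card {i : Fin N // ¬ GoodShell
            ((Measure.count : Measure (EuclideanSpace ℝ (Fin 3))).restrict ((fun z => z - y i) '' Set.range y))} : ℝ) →
        (N : ℝ) * (eStar + κ) ≤ interactionEnergy lennardJones y := by
  intro hper t ht
  obtain ⟨κ, hκ, s, hs, hQ⟩ := hper t ht
  refine ⟨κ, hκ, s, hs, fun N y hy hgood hbad => ?_⟩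
  rcases Nat.eq_zero_or_pos N with rfl | hN
  · simp [interactionEnergy]
  · set Q := periodise y (periodUnit y) le_rfl hN with hQdef
    have hcard : Q.motif.card = N := by
      rw [hQdef, motif_periodise, Finset.card_image_of_injective _ hy, Finset.card_univ,
        Fintype.card_fin]
    have hle := natCard_bad_le_natCard_badMotif_periodise hy hN
    have hle' := natCard_notSetGoodMotif_periodise_le y hN
    have hbud : (Nat.card {x : Q.motif // ¬ SetGood Q.points (x : EuclideanSpace ℝ (Fin 3))} : ℝ) ≤
        s * (Q.motif.card : ℝ) := by
      rw [hcard]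
      exact le_trans (by exact_mod_cast hle') hgood
    have hthr : t * (Q.motif.card : ℝ) ≤ (Nat.card {x : Q.motif // ¬ GoodShell
        ((Measure.count : Measure (EuclideanSpace ℝ (Fin 3))).restrict
          ((fun z => z - (x : EuclideanSpace ℝ (Fin 3))) '' Q.points))} : ℝ) := by
      rw [hcard]
      exact hbad.trans (by exact_mod_cast hle)
    have h1 : eStar + κ ≤ Q.energyPerParticle lennardJones := hQ Q hbud hthr
    have h2 : Q.energyPerParticle lennardJones ≤ interactionEnergy lennardJones y / N :=
      energyPerParticle_periodise_le hy (periodUnit y) le_rfl hN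
    have hNr : (0 : ℝ) < N := by exact_mod_cast hN
    have h3 := h1.trans h2
    rwa [le_div_iff₀ hNr, mul_comm] at h3

end Summit.AtomisticToContinuum.Crystallization.Theorems.PalmGoodLaw.FunnelFiniteGap

end
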